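import Summits.Ventures.LatticeQCDFlow.Scoring.HalvesTest
import Summits.Ventures.LatticeQCDFlow.Scoring.VarianceOfTheMean

/-!
# Thinning (the `n_meas` / stride lever): measuring every `k`-th update never improves the error of the mean at fixed updates, and quoting `k · τ` from the thinned series never under-states `τ_int`

HONEST FRAMING: exact (Metropolis-corrected) sampling algorithms for lattice gauge theory;
figures of merit are autocorrelation/cost numbers at stated couplings and volumes; no
continuum-physics claim.

Venture `LatticeQCDFlow` (cell pub-lqcd), sub-topic `Scoring`; FANOUT row 11 (`eng-scorerA`,
fitness scorer A).  NEW WORK of the cell in the sense of the placement rule (our own elementary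
proof: a reindexing identity plus `Scoring/HalvesTest.variance_avg_le`); the variance statement is
known — MacEachern & Berliner, *Subsampling the Gibbs sampler*, The American Statistician 48 (1994)
188–190, prove that the full-sample average is never worse than the sub-sampled one for a stationary
sequence — and is named here, not cited as a tree fact.

## Why the scorer cares

A chain file declares its measurement stride (levers `n_meas` / `meas_interval`; scorer A's
`update_unit`, `n_meas_stride`): row 21's two SU(3) P0 streams at the same target were stored every
10 updates (seg1, LEADERBOARD `r-17aad7b38211`, `τ̂_int(Q²) = 7.4 ± 1.1` updates) and every 2 updates
(the 'fine' refinement stream, `16.5 ± 4.9` updates).  Two population facts frame such comparisons: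

* `fullMean_eq_avg_thinnedMean` — with `N = k·m` stored samples, the full mean is the plain average
  of the `k` stride-`k` sub-sample means with offsets `j = 0, …, k−1`;
* `variance_fullMean_le_avg`, `variance_fullMean_le_of_forall_le` (**MacEachern–Berliner**) —
  hence `Var(full mean) ≤ (1/k) ∑_j Var(offset-j thinned mean) ≤ max_j Var(thinned mean)`: for ANY
  square-integrable sequence, discarding samples (at fixed update cost) cannot reduce the variance of
  the mean below the WORST offset; `variance_thinnedMean_eq_of_cov_eq` — under lag-only covariances
  on the window (`Cov(X_a, X_b) = C |a − b|`, weak stationarity) every offset has the same variance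
  `(1/m²) ∑_{i,i'<m} C (k |i − i'|)`, so `Var(full) ≤ Var(thinned)` outright
  (`variance_fullMean_le_thinnedMean_of_cov_eq`);
* `tauIntN_le_stride_mul` — read through `Scoring/VarianceOfTheMean.variance_mean_range_of_cov_eq`
  (`Var(mean of n) = 2 τ_n σ²/n` with the finite-`n` Fejér `τ_n`): for every normalised
  autocorrelation `ρ` REALISED by such a window with `σ² > 0`,
  **`τ_{km}(ρ) ≤ k · τ_m(ρ ∘ (k·))`** — the integrated autocorrelation time quoted in UPDATE units from
  a stride-`k` series (`k ×` the thinned series' own `τ`) is never below the every-update value: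
  thinning can only move a boarded `τ̂_int` UP (population statement; the estimator's noise is the
  calibration's business);
* the calibration family C-1 in closed form (`tauInt_geometric`): `ρ_t = r^t` thinned by `k` is
  geometric with ratio `r^k`, and `tauInt_le_stride_mul_tauInt_geometric` —
  `τ_int(r) = (1+r)/(2(1−r)) ≤ k (1+r^k)/(2(1−r^k))` for `0 ≤ r < 1` (core inequality
  `one_add_mul_geom_sum_le`: `(1+r) ∑_{i<k} r^i ≤ k (1 + r^k)`, by induction with the Bernoulli-type
  step `(k+1) r^k ≤ 1 + k r^{k+1}`); at the fine stream's central value `τ_int = 33/2` updates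
  (`r = 16/17`) stride 2 reads `545/33 ≈ 16.52` and stride 10 reads `< 17` (`tauInt_update_units_*`):
  the population effect of the 2-vs-10-update spacing is below `3.1 %`, so a factor-2 difference
  between two streams' `τ̂` at these strides is statistics or physics, not spacing — and its SIGN
  (finer spacing reading HIGHER) is the one direction thinning cannot produce.

What is NOT here: measurement COST (scorer A's `F₃ = err² · C_total` charges `c_meas` per stored
sample, so at fixed wall-clock a larger stride can win — that trade-off is arithmetic on measured
costs, BASELINES/EFFICIENCY, not a theorem), and the noise of `τ̂` (CALIBRATION-A of record).
-/

namespace Summit.Ventures.LatticeQCDFlow.Scoring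

open Finset MeasureTheory ProbabilityTheory
open scoped BigOperators

/-! ### Reindexing: the full mean is the average of the offset sub-sample means -/

/-- Splitting `range (k·m)` into `m` consecutive blocks of length `k`:
`∑_{n < k m} f n = ∑_{i<m} ∑_{j<k} f (k i + j)`. -/
theorem sum_range_mul_eq_sum_sum {β : Type*} [AddCommMonoid β] (f : ℕ → β) (k m : ℕ) :
    ∑ n ∈ range (k * m), f n = ∑ i ∈ range m, ∑ j ∈ range k, f (k * i + j) := by
  induction m with
  | zero => simp
  | succ m ih => rw [Nat.mul_succ, Finset.sum_range_add, ih, Finset.sum_range_succ]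

/-- The same sum organised by OFFSET: `∑_{n < k m} f n = ∑_{j<k} ∑_{i<m} f (j + k i)` — the
stride-`k` sub-sequences with offsets `j = 0, …, k−1` partition the window. -/
theorem sum_range_mul_eq_sum_offset {β : Type*} [AddCommMonoid β] (f : ℕ → β) (k m : ℕ) :
    ∑ n ∈ range (k * m), f n = ∑ j ∈ range k, ∑ i ∈ range m, f (j + k * i) := by
  rw [sum_range_mul_eq_sum_sum, Finset.sum_comm]
  refine Finset.sum_congr rfl fun j _ => Finset.sum_congr rfl fun i _ => ?_
  rw [add_comm]

variable {Ω : Type*} {mΩ : MeasurableSpace Ω} {μ : Measure Ω} [IsProbabilityMeasure μ]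

/-- The mean of all `N` stored samples `X₀, …, X_{N−1}`. -/
noncomputable def fullMean (X : ℕ → Ω → ℝ) (N : ℕ) : Ω → ℝ :=
  fun ω => (∑ n ∈ range N, X n ω) / N

/-- The stride-`k` (thinned) sub-sample mean with offset `j`: `(1/m) ∑_{i<m} X_{j + k i}`. -/
noncomputable def thinnedMean (X : ℕ → Ω → ℝ) (k j m : ℕ) : Ω → ℝ :=
  fun ω => (∑ i ∈ range m, X (j + k * i) ω) / m

section

variable {X : ℕ → Ω → ℝ} {k m : ℕ}

omit [IsProbabilityMeasure μ] in
/-- **The full mean is the plain average of the `k` offset sub-sample means** (`N = k m`,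
`k, m ≥ 1`): `x̄_N = (1/k) ∑_{j<k} x̄^{(k, j)}_m`. -/
theorem fullMean_eq_avg_thinnedMean (hk : k ≠ 0) (hm : m ≠ 0) :
    fullMean X (k * m) = fun ω => (∑ j ∈ range k, thinnedMean X k j m ω) / k := by
  funext ω
  unfold fullMean thinnedMean
  have hk' : (k : ℝ) ≠ 0 := by exact_mod_cast hk
  have hm' : (m : ℝ) ≠ 0 := by exact_mod_cast hm
  rw [sum_range_mul_eq_sum_offset (fun n => X n ω) k m, ← Finset.sum_div, div_div, Nat.cast_mul,
    mul_comm (m : ℝ)]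

omit [IsProbabilityMeasure μ] in
/-- A thinned mean of square-integrable samples is square integrable. -/
theorem memLp_thinnedMean (hX : ∀ n < k * m, MemLp (X n) 2 μ) {j : ℕ} (hj : j < k) :
    MemLp (thinnedMean X k j m) 2 μ :=
  memLp_div_const (memLp_finsetSum (range m) fun i hi => hX (j + k * i) (by
    have hi' := mem_range.mp hi
    have : k * i + k ≤ k * m := by rw [← Nat.mul_succ]; exact Nat.mul_le_mul_left k hi'
    omega)) _

/-- **MacEachern–Berliner, averaged form.**  `Var(x̄_N) ≤ (1/k) ∑_{j<k} Var(x̄^{(k,j)}_m)` for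
every square-integrable window of `N = k m` samples — no stationarity needed. -/
theorem variance_fullMean_le_avg (hk : k ≠ 0) (hm : m ≠ 0) (hX : ∀ n < k * m, MemLp (X n) 2 μ) :
    Var[fullMean X (k * m); μ] ≤ (∑ j ∈ range k, Var[thinnedMean X k j m; μ]) / k := by
  rw [fullMean_eq_avg_thinnedMean hk hm]
  exact variance_avg_le hk (fun j => thinnedMean X k j m) fun j hj => memLp_thinnedMean hX hj

/-- **MacEachern–Berliner.**  If every offset's thinned mean has variance `≤ V` then so has the
full mean: discarding `k−1` of every `k` samples cannot push the variance of the mean below the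
worst offset's. -/
theorem variance_fullMean_le_of_forall_le (hk : k ≠ 0) (hm : m ≠ 0)
    (hX : ∀ n < k * m, MemLp (X n) 2 μ) {V : ℝ}
    (hV : ∀ j < k, Var[thinnedMean X k j m; μ] ≤ V) :
    Var[fullMean X (k * m); μ] ≤ V := by
  refine (variance_fullMean_le_avg hk hm hX).trans ?_
  have hk' : (0 : ℝ) < k := by exact_mod_cast Nat.pos_of_ne_zero hk
  rw [div_le_iff₀ hk']
  calc ∑ j ∈ range k, Var[thinnedMean X k j m; μ] ≤ ∑ _j ∈ range k, V :=
        Finset.sum_le_sum fun j hj => hV j (mem_range.mp hj)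
    _ = V * k := by rw [Finset.sum_const, Finset.card_range, nsmul_eq_mul, mul_comm]

/-- The equal-variance case (what stationarity delivers, next lemma): `Var(x̄_N) ≤ Var(x̄^{(k,0)}_m)`. -/
theorem variance_fullMean_le_thinnedMean_of_eq (hk : k ≠ 0) (hm : m ≠ 0)
    (hX : ∀ n < k * m, MemLp (X n) 2 μ)
    (hV : ∀ j < k, Var[thinnedMean X k j m; μ] = Var[thinnedMean X k 0 m; μ]) :
    Var[fullMean X (k * m); μ] ≤ Var[thinnedMean X k 0 m; μ] :=
  variance_fullMean_le_of_forall_le hk hm hX fun j hj => (hV j hj).le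

/-! ### Lag-only covariances on the window (weak stationarity): every offset has the same variance -/

/-- Under `Cov(X_a, X_b) = C |a − b|` on the window, the offset-`j` thinned mean has variance
`(1/m²) ∑_{i<m} ∑_{i'<m} C (k |i − i'|)` — independent of the offset. -/
theorem variance_thinnedMean_eq_of_cov_eq (hX : ∀ n < k * m, MemLp (X n) 2 μ) (C : ℕ → ℝ)
    (hC : ∀ a < k * m, ∀ b < k * m, cov[X a, X b; μ] = C (Nat.dist a b)) {j : ℕ} (hj : j < k) :
    Var[thinnedMean X k j m; μ]
      = (∑ i ∈ range m, ∑ i' ∈ range m, C (k * Nat.dist i i')) / (m : ℝ) ^ 2 := by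
  have hidx : ∀ i < m, j + k * i < k * m := by
    intro i hi
    have : k * i + k ≤ k * m := by rw [← Nat.mul_succ]; exact Nat.mul_le_mul_left k hi
    omega
  have hY : ∀ i ∈ range m, MemLp (X (j + k * i)) 2 μ :=
    fun i hi => hX _ (hidx i (mem_range.mp hi))
  unfold thinnedMean
  have h1 : (fun ω => (∑ i ∈ range m, X (j + k * i) ω) / m)
      = fun ω => (∑ i ∈ range m, X (j + k * i) ω) * (m : ℝ)⁻¹ := by
    funext ω; rw [div_eq_mul_inv]
  rw [h1, variance_mul_const, variance_fun_sum' hY, div_eq_mul_inv, inv_pow]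
  congr 1
  refine Finset.sum_congr rfl fun i hi => Finset.sum_congr rfl fun i' hi' => ?_
  rw [hC _ (hidx i (mem_range.mp hi)) _ (hidx i' (mem_range.mp hi')), Nat.dist_add_add_left,
    Nat.dist_mul_left]

/-- **MacEachern–Berliner under weak stationarity on the window:** `Var(x̄_N) ≤ Var(x̄^{(k,0)}_m)`
— the mean of all `N = k m` samples is never worse than the mean of every `k`-th one. -/
theorem variance_fullMean_le_thinnedMean_of_cov_eq (hk : k ≠ 0) (hm : m ≠ 0)
    (hX : ∀ n < k * m, MemLp (X n) 2 μ) (C : ℕ → ℝ)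
    (hC : ∀ a < k * m, ∀ b < k * m, cov[X a, X b; μ] = C (Nat.dist a b)) :
    Var[fullMean X (k * m); μ] ≤ Var[thinnedMean X k 0 m; μ] :=
  variance_fullMean_le_thinnedMean_of_eq hk hm hX fun j hj => by
    rw [variance_thinnedMean_eq_of_cov_eq hX C hC hj,
      variance_thinnedMean_eq_of_cov_eq hX C hC (Nat.pos_of_ne_zero hk)]

/-! ### In `τ` language: `τ_N(ρ) ≤ k · τ_m(ρ ∘ (k·))` for every realised autocorrelation -/

/-- The thinned series is weakly stationary with the thinned autocorrelation: its mean of `m` has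
variance `2 τ_m(ρ_k) σ² / m` with `ρ_k t = ρ (k t)` (`VarianceOfTheMean.variance_mean_range_of_cov_eq`
applied to `i ↦ X_{j + k i}`). -/
theorem variance_thinnedMean_eq_tauIntN (hm : m ≠ 0) (hX : ∀ n < k * m, MemLp (X n) 2 μ)
    (σ2 : ℝ) (ρ : ℕ → ℝ) (hρ : ρ 0 = 1)
    (hC : ∀ a < k * m, ∀ b < k * m, cov[X a, X b; μ] = σ2 * ρ (Nat.dist a b)) {j : ℕ}
    (hj : j < k) :
    Var[thinnedMean X k j m; μ] = 2 * tauIntN (fun t => ρ (k * t)) m * σ2 / m := by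
  have hidx : ∀ i < m, j + k * i < k * m := by
    intro i hi
    have : k * i + k ≤ k * m := by rw [← Nat.mul_succ]; exact Nat.mul_le_mul_left k hi
    omega
  unfold thinnedMean
  refine variance_mean_range_of_cov_eq (fun i => X (j + k * i)) σ2 (fun t => ρ (k * t))
    (by simpa using hρ) hm (fun i hi => hX _ (hidx i hi)) fun i hi i' hi' => ?_
  rw [hC _ (hidx i hi) _ (hidx i' hi'), Nat.dist_add_add_left, Nat.dist_mul_left]

/-- And the full mean: `Var(x̄_N) = 2 τ_N(ρ) σ² / N`, `N = k m` (restated on `fullMean`). -/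
theorem variance_fullMean_eq_tauIntN (hN : k * m ≠ 0) (hX : ∀ n < k * m, MemLp (X n) 2 μ)
    (σ2 : ℝ) (ρ : ℕ → ℝ) (hρ : ρ 0 = 1)
    (hC : ∀ a < k * m, ∀ b < k * m, cov[X a, X b; μ] = σ2 * ρ (Nat.dist a b)) :
    Var[fullMean X (k * m); μ] = 2 * tauIntN ρ (k * m) * σ2 / (k * m : ℕ) :=
  variance_mean_range_of_cov_eq X σ2 ρ hρ hN hX hC

/-- **Thinning never under-states `τ_int` (finite-`N`, population version).**  If `ρ` is the
normalised lag-only autocorrelation of a square-integrable window of `N = k m` samples with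
variance `σ² > 0`, then `τ_N(ρ) ≤ k · τ_m(ρ ∘ (k·))`: `k` times the Fejér integrated autocorrelation
time of the stride-`k` series is at least that of the full series. -/
theorem tauIntN_le_stride_mul (hk : k ≠ 0) (hm : m ≠ 0) (hX : ∀ n < k * m, MemLp (X n) 2 μ)
    {σ2 : ℝ} (hσ : 0 < σ2) (ρ : ℕ → ℝ) (hρ : ρ 0 = 1)
    (hC : ∀ a < k * m, ∀ b < k * m, cov[X a, X b; μ] = σ2 * ρ (Nat.dist a b)) :
    tauIntN ρ (k * m) ≤ k * tauIntN (fun t => ρ (k * t)) m := by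
  have hN : k * m ≠ 0 := Nat.mul_ne_zero hk hm
  have hk' : (0 : ℝ) < k := by exact_mod_cast Nat.pos_of_ne_zero hk
  have hm' : (0 : ℝ) < m := by exact_mod_cast Nat.pos_of_ne_zero hm
  have h := variance_fullMean_le_thinnedMean_of_cov_eq hk hm hX (fun t => σ2 * ρ t) hC
  rw [variance_fullMean_eq_tauIntN hN hX σ2 ρ hρ hC,
    variance_thinnedMean_eq_tauIntN hm hX σ2 ρ hρ hC (Nat.pos_of_ne_zero hk), Nat.cast_mul] at h
  -- h : 2 τ_N σ² / (k m) ≤ 2 τ_m(ρ_k) σ² / m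
  rw [div_le_div_iff₀ (mul_pos hk' hm') hm'] at h
  -- h : 2 τ_N σ² · m ≤ 2 τ_m(ρ_k) σ² · (k m)
  have h2 : 0 < 2 * σ2 * m := by positivity
  nlinarith [h, h2]

end

/-! ### The calibration family C-1: geometric autocorrelation thinned by `k` -/

/-- **Core inequality.**  `(1 + r) ∑_{i<k} r^i ≤ k (1 + r^k)` for `0 ≤ r ≤ 1`; by induction on `k`,
the step being the Bernoulli-type bound `(k+1) r^k ≤ 1 + k r^{k+1}`
(`= r^k (1 + k(1−r)) ≤ r^k (2 − r)^k = (r(2−r))^k ≤ 1`). -/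
theorem one_add_mul_geom_sum_le {r : ℝ} (hr0 : 0 ≤ r) (hr1 : r ≤ 1) (k : ℕ) :
    (1 + r) * ∑ i ∈ range k, r ^ i ≤ k * (1 + r ^ k) := by
  induction k with
  | zero => simp
  | succ k ih =>
    -- the step inequality (k+1) r^k ≤ 1 + k r^(k+1)
    have hstep : ((k : ℝ) + 1) * r ^ k ≤ 1 + k * r ^ (k + 1) := by
      have hb : 1 + (k : ℝ) * (1 - r) ≤ (1 + (1 - r)) ^ k :=
        one_add_mul_le_pow (by linarith) k
      have hrk : 0 ≤ r ^ k := pow_nonneg hr0 k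
      have h1 : r ^ k * (1 + (k : ℝ) * (1 - r)) ≤ r ^ k * (1 + (1 - r)) ^ k :=
        mul_le_mul_of_nonneg_left hb hrk
      have h2 : r ^ k * (1 + (1 - r)) ^ k = (r * (2 - r)) ^ k := by
        rw [mul_pow]; ring
      have h3 : (r * (2 - r)) ^ k ≤ 1 := by
        refine pow_le_one₀ (by nlinarith) ?_
        nlinarith [sq_nonneg (1 - r)]
      have h4 : r ^ k * (1 + (k : ℝ) * (1 - r)) = ((k : ℝ) + 1) * r ^ k - k * r ^ (k + 1) := by
        ring
      linarith [h1, h2 ▸ h3]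
    rw [Finset.sum_range_succ, mul_add, Nat.cast_succ]
    calc (1 + r) * ∑ i ∈ range k, r ^ i + (1 + r) * r ^ k
        ≤ k * (1 + r ^ k) + (1 + r) * r ^ k := by linarith [ih]
      _ = k + ((k : ℝ) + 1) * r ^ k + r ^ (k + 1) := by ring
      _ ≤ k + (1 + k * r ^ (k + 1)) + r ^ (k + 1) := by linarith [hstep]
      _ = ((k : ℝ) + 1) * (1 + r ^ (k + 1)) := by ring

/-- **C-1 thinned by `k`.**  For `0 ≤ r < 1` and `k ≥ 1`:
`τ_int(r) = (1+r)/(2(1−r)) ≤ k · (1+r^k)/(2(1−r^k)) = k · τ_int(r^k)` — the stride-`k` series of an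
AR(1)/geometric chain is geometric with ratio `r^k`, and `k` times its integrated autocorrelation
time (thinned-sample units → update units) is at least the every-update `τ_int`. -/
theorem tauInt_le_stride_mul_tauInt_geometric {r : ℝ} (hr0 : 0 ≤ r) (hr1 : r < 1) {k : ℕ}
    (hk : k ≠ 0) :
    tauInt (fun t => r ^ t) ≤ k * tauInt (fun t => (r ^ k) ^ t) := by
  have habs : |r| < 1 := abs_lt.mpr ⟨by linarith, hr1⟩
  have hrk1 : r ^ k < 1 := pow_lt_one₀ hr0 hr1 hk
  have hrk0 : 0 ≤ r ^ k := pow_nonneg hr0 k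
  have habsk : |r ^ k| < 1 := abs_lt.mpr ⟨by linarith, hrk1⟩
  rw [tauInt_geometric habs, tauInt_geometric habsk]
  have hS : (1 - r) * ∑ i ∈ range k, r ^ i = 1 - r ^ k := mul_neg_geom_sum r k
  have hcore := one_add_mul_geom_sum_le hr0 hr1.le k
  have h1r : 0 < 1 - r := by linarith
  have h1rk : 0 < 1 - r ^ k := by linarith
  rw [div_le_iff₀ (by positivity), mul_comm (k : ℝ), mul_assoc,
    div_mul_eq_mul_div, le_div_iff₀ (by positivity)]
  -- goal: (1 + r) * (2 * (1 - r^k)) ≤ (1 + r^k) * k * (2 * (1 - r))  (up to ring)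
  have key : (1 + r) * (1 - r ^ k) ≤ k * (1 + r ^ k) * (1 - r) := by
    rw [← hS]
    have := mul_le_mul_of_nonneg_left hcore h1r.le
    nlinarith [this]
  nlinarith [key]

/-- Composition: thinning a stride-`k` series further by `l` — apply the previous lemma to `r^k`:
`k τ_int(r^k) ≤ (k l) τ_int(r^{k l})`.  So along divisibility the update-unit reading is monotone
in the stride. -/
theorem stride_mul_tauInt_geometric_mono {r : ℝ} (hr0 : 0 ≤ r) (hr1 : r < 1) {k l : ℕ}
    (hl : l ≠ 0) :
    (k : ℝ) * tauInt (fun t => (r ^ k) ^ t) ≤ (k * l : ℕ) * tauInt (fun t => (r ^ (k * l)) ^ t) := by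
  rcases Nat.eq_zero_or_pos k with rfl | hkpos
  · simp
  have hrk0 : 0 ≤ r ^ k := pow_nonneg hr0 k
  have hrk1 : r ^ k < 1 := pow_lt_one₀ hr0 hr1 hkpos.ne'
  have h := tauInt_le_stride_mul_tauInt_geometric hrk0 hrk1 hl
  rw [← pow_mul] at h
  rw [Nat.cast_mul, mul_assoc]
  exact mul_le_mul_of_nonneg_left h (Nat.cast_nonneg k)

/-! ### The record's numbers: `τ_int = 33/2` updates read at stride 2 and stride 10 -/

/-- `r = 16/17` is the geometric chain with `τ_int = 33/2 = 16.5` updates (the fine stream's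
central value `16.5 ± 4.9`). -/
theorem tauInt_sixteen_seventeenths : tauInt (fun t => (16 / 17 : ℝ) ^ t) = 33 / 2 := by
  rw [tauInt_geometric (abs_lt.mpr ⟨by norm_num, by norm_num⟩)]
  norm_num

/-- Stride 2 (the fine stream's `n_meas = 2`): `2 τ_int(r²) = (1 + r²)/(1 − r²) = 545/33 ≈ 16.52`
updates — `0.09 %` above `33/2`. -/
theorem tauInt_update_units_stride_two :
    2 * tauInt (fun t => (((16 : ℝ) / 17) ^ 2) ^ t) = 545 / 33 := by
  rw [tauInt_geometric (abs_lt.mpr ⟨by norm_num, by norm_num⟩)]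
  norm_num

/-- Stride 10 (seg1's `n_meas = 10`): `10 τ_int(r¹⁰) < 17` updates, i.e. less than `3.1 %` above
`33/2` — the population effect of the coarser spacing is far inside the printed `± 30 %`, and it
can only RAISE the number (`tauInt_le_stride_mul_tauInt_geometric`): a stride-10 reading BELOW a
stride-2 reading of the same process (7.4 vs 16.5) is not a spacing effect. -/
theorem tauInt_update_units_stride_ten :
    10 * tauInt (fun t => (((16 : ℝ) / 17) ^ 10) ^ t) < 17 := by
  rw [tauInt_geometric (abs_lt.mpr ⟨by norm_num, by norm_num⟩)]
  norm_num

/-- Lower side of the same bracket: the stride-10 reading is at least `33/2` (an instance of the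
general lemma, recorded as a number). -/
theorem tauInt_update_units_stride_ten_ge :
    (33 : ℝ) / 2 ≤ 10 * tauInt (fun t => (((16 : ℝ) / 17) ^ 10) ^ t) := by
  rw [← tauInt_sixteen_seventeenths]
  exact_mod_cast tauInt_le_stride_mul_tauInt_geometric (r := 16 / 17) (k := 10)
    (by norm_num) (by norm_num) (by norm_num)

end Summit.Ventures.LatticeQCDFlow.Scoring
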